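import Literature.Topology.PlanarFoliations.BiOrient
import Literature.Topology.FourManifolds.TautFoliationsLeafPaths
import HarnessLib

/-!
# Arc charts on the leaves of a foliation with one-dimensional leaves

Topic: Topology / PlanarFoliations. For a foliation `F : Foliation ℝ X` with one-dimensional
leaves, a leaf `F.Leaf x` in its leaf topology (`TautFoliationsLeafTopology.lean`: the open
subset `F.leaf x` of the leaf space `M^δ`, a connected Hausdorff space, second countable when
`X` is) is covered by **arc charts** in the sense of the tree's topological core of Milnor's
classification of one-manifolds (`Literature/Topology/FourManifolds/OneManifold*.lean`: open
partial homeomorphisms onto the whole real line): the **leaf arcs** `leafArc`, inverses of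
the plaque maps `b ↦ e.symm (b, t)` of the flow boxes whose plaque at height `t` lies in the
leaf, reading the leaf coordinate `(e ·).1`.

* `leafArc` (**definition**) and its API (`leafArc_target`, `mem_leafArc_source_iff`,
  `leafArc_apply`, `leafArc_symm_apply`), **every point of a leaf lies in a leaf arc**
  (`exists_mem_leafArc_source`);
* **for a bi-oriented atlas the leaf arcs are pairwise compatible** (`eventually_lt_iff_leafArc`):
  two leaf arcs induce the same local order at every common point — the datum Milnor's lemma and
  the orientation of one-manifolds are built from (`OneManifoldTwoCharts.lean`,
  `OneManifoldCompatibleCover.lean`).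

So the leaves of a bi-oriented planar foliation are oriented `1`-manifolds in a form to which
the tree's classification applies (`LeafStructure.lean`, to follow: closed leaves are covered
by two compatible leaf-oriented arcs, open leaves by a nested exhausting sequence of them).
All statements are [folklore].
-/

noncomputable section

open Set Filter Function
open _root_.Topology
open Literature.Topology.FourManifolds Literature.Topology.FourManifolds.Foliation

namespace Literature.Topology.PlanarFoliations

variable {X : Type*} [TopologicalSpace X] (F : Foliation ℝ X)
variable {e e' : OpenPartialHomeomorph X (ℝ × ℝ)} {t t' : ℝ} {x : X}

/-! ## Leaf arcs -/

section LeafArc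

variable {F}

/-- The plaque map into the leaf `F.Leaf x`, for a plaque lying in the leaf. [folklore] -/
def leafArcMap (e : OpenPartialHomeomorph X (ℝ × ℝ)) (t : ℝ) (h : plaque e t ⊆ F.leaf x)
    (he : e ∈ F.atlas) (b : ℝ) : F.Leaf x :=
  ⟨F.leafPlaqueMap e t b, h (plaqueMap_mem_plaque F he t b)⟩

/-- The underlying point of the plaque map into the leaf. [folklore] -/
@[simp] theorem coe_leafArcMap (h : plaque e t ⊆ F.leaf x) (he : e ∈ F.atlas) (b : ℝ) :
    ((leafArcMap e t h he b : F.Leaf x) : F.LeafSpace) = F.leafPlaqueMap e t b := rfl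

/-- The plaque map into the leaf is an open embedding of `ℝ`. [folklore] -/
theorem isOpenEmbedding_leafArcMap (h : plaque e t ⊆ F.leaf x) (he : e ∈ F.atlas) :
    IsOpenEmbedding (leafArcMap e t h he) := by
  have hoe := F.isOpenEmbedding_leafPlaqueMap he t
  have hmem : ∀ b, F.leafPlaqueMap e t b ∈ (F.leafOpens x : Set F.LeafSpace) := fun b ↦
    h (plaqueMap_mem_plaque F he t b)
  have hemb : IsEmbedding (leafArcMap e t h he) := hoe.isEmbedding.codRestrict _ hmem
  refine ⟨hemb, ?_⟩
  have : range (leafArcMap e t h he) = Subtype.val ⁻¹' range (F.leafPlaqueMap e t) := by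
    ext p
    constructor
    · rintro ⟨b, rfl⟩; exact ⟨b, rfl⟩
    · rintro ⟨b, hb⟩; exact ⟨b, Subtype.ext hb⟩
  rw [this]
  exact hoe.isOpen_range.preimage continuous_subtype_val

/-- **Leaf arcs**: the arc chart of the leaf `F.Leaf x` inverse to the plaque map of the flow
box `e` at height `t` (a plaque lying in the leaf), reading the leaf coordinate. [folklore] -/
def leafArc (e : OpenPartialHomeomorph X (ℝ × ℝ)) (t : ℝ) (h : plaque e t ⊆ F.leaf x) (he : e ∈ F.atlas) :
    OpenPartialHomeomorph (F.Leaf x) ℝ :=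
  ((isOpenEmbedding_leafArcMap h he).toOpenPartialHomeomorph (leafArcMap e t h he)).symm

/-- The inverse of a leaf arc is the plaque map. [folklore] -/
@[simp] theorem leafArc_symm_apply (h : plaque e t ⊆ F.leaf x) (he : e ∈ F.atlas) (b : ℝ) :
    (leafArc e t h he).symm b = leafArcMap e t h he b := rfl

/-- **Leaf arcs are arc charts**: their target is the whole line. [folklore] -/
@[simp] theorem leafArc_target (h : plaque e t ⊆ F.leaf x) (he : e ∈ F.atlas) : (leafArc e t h he).target = univ := by
  rw [leafArc, OpenPartialHomeomorph.symm_target, IsOpenEmbedding.toOpenPartialHomeomorph_source]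

/-- The source of a leaf arc is its plaque. [folklore] -/
theorem mem_leafArc_source_iff (h : plaque e t ⊆ F.leaf x) (he : e ∈ F.atlas) {p : F.Leaf x} :
    p ∈ (leafArc e t h he).source ↔ ofLeafSpace (p : F.LeafSpace) ∈ plaque e t := by
  rw [leafArc, OpenPartialHomeomorph.symm_source, IsOpenEmbedding.toOpenPartialHomeomorph_target]
  constructor
  · rintro ⟨b, rfl⟩
    exact plaqueMap_mem_plaque F he t b
  · intro hp
    refine ⟨(e (ofLeafSpace (p : F.LeafSpace))).1, Subtype.ext ?_⟩
    show F.leafPlaqueMap e t _ = (p : F.LeafSpace)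
    exact (ofLeafSpace (F := F)).injective (plaqueMap_fst_eq hp)

/-- **A leaf arc reads the leaf coordinate of its flow box.** [folklore] -/
theorem leafArc_apply (h : plaque e t ⊆ F.leaf x) (he : e ∈ F.atlas) {p : F.Leaf x}
    (hp : p ∈ (leafArc e t h he).source) : leafArc e t h he p = (e (ofLeafSpace (p : F.LeafSpace))).1 := by
  have hpt := (mem_leafArc_source_iff h he).1 hp
  have key : (leafArc e t h he).symm (e (ofLeafSpace (p : F.LeafSpace))).1 = p := by
    rw [leafArc_symm_apply]
    exact Subtype.ext ((ofLeafSpace (F := F)).injective (plaqueMap_fst_eq hpt))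
  conv_lhs => rw [← key]
  exact (leafArc e t h he).right_inv (by rw [leafArc_target]; exact mem_univ _)

/-- The height of a point of the source of a leaf arc. [folklore] -/
theorem snd_eq_of_mem_leafArc_source (h : plaque e t ⊆ F.leaf x) (he : e ∈ F.atlas) {p : F.Leaf x}
    (hp : p ∈ (leafArc e t h he).source) : (e (ofLeafSpace (p : F.LeafSpace))).2 = t :=
  ((mem_leafArc_source_iff h he).1 hp).2

/-- **Every point of a leaf lies in the source of a leaf arc** (the plaque through it of any
flow box around it). [folklore] -/
theorem exists_mem_leafArc_source (p : F.Leaf x) :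
    ∃ (e : OpenPartialHomeomorph X (ℝ × ℝ)) (he : e ∈ F.atlas) (t : ℝ) (h : plaque e t ⊆ F.leaf x),
      p ∈ (leafArc e t h he).source := by
  obtain ⟨e, he, hpe⟩ := F.exists_mem_source (ofLeafSpace (p : F.LeafSpace))
  have hpl : ofLeafSpace (p : F.LeafSpace) ∈ plaque e (e (ofLeafSpace (p : F.LeafSpace))).2 := mem_plaque_self hpe
  refine ⟨e, he, _, F.plaque_subset_leaf_of_mem he p.2 hpl, ?_⟩
  rwa [mem_leafArc_source_iff]

/-- **The sources of the leaf arcs are open in the leaf.** [folklore] -/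
theorem isOpen_leafArc_source (h : plaque e t ⊆ F.leaf x) (he : e ∈ F.atlas) : IsOpen (leafArc e t h he).source :=
  (leafArc e t h he).open_source

end LeafArc

/-! ## Compatibility of the leaf arcs of a bi-oriented atlas -/

section Compatible

variable {F}

/-- In the leaf topology, points near `p` in the source of a leaf arc eventually stay in it and
inside any neighbourhood of `p` in `X`. [folklore] -/
theorem eventually_mem_leafArc_source (h : plaque e t ⊆ F.leaf x) (he : e ∈ F.atlas) {p : F.Leaf x}
    (hp : p ∈ (leafArc e t h he).source) {U : Set X} (hU : U ∈ 𝓝 (ofLeafSpace (p : F.LeafSpace))) :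
    ∀ᶠ q in 𝓝 p, q ∈ (leafArc e t h he).source ∧ ofLeafSpace (q : F.LeafSpace) ∈ U := by
  filter_upwards [(isOpen_leafArc_source h he).mem_nhds hp,
    (Leaf.continuous_coe F x).continuousAt.preimage_mem_nhds hU] with q hq hq'
  exact ⟨hq, hq'⟩

/-- **The leaf arcs of a bi-oriented atlas induce the same local order** at every common point
of their sources: this is the compatibility required by Milnor's lemma
(`OneManifold.union_or_cover`) and by the orientation of one-manifolds
(`OneManifold.exists_compatible_arcCharts_nat`). Near `p` in the leaf topology the points stay
on the plaques of both boxes through `p`, where by bi-orientation the two leaf coordinates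
increase together. [folklore] -/
theorem eventually_lt_iff_leafArc (hbi : IsBiOriented F) (h : plaque e t ⊆ F.leaf x) (he : e ∈ F.atlas)
    (h' : plaque e' t' ⊆ F.leaf x) (he' : e' ∈ F.atlas) {p : F.Leaf x}
    (hp : p ∈ (leafArc e t h he).source) (hp' : p ∈ (leafArc e' t' h' he').source) :
    ∀ᶠ q in 𝓝 p, (leafArc e t h he q < leafArc e t h he p ↔ leafArc e' t' h' he' q < leafArc e' t' h' he' p) ∧
      (leafArc e t h he p < leafArc e t h he q ↔ leafArc e' t' h' he' p < leafArc e' t' h' he' q) := by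
  set y : X := ofLeafSpace (p : F.LeafSpace) with hy
  have hy₁ : y ∈ e.source := ((mem_leafArc_source_iff h he).1 hp).1
  have hy₂ : y ∈ e'.source := ((mem_leafArc_source_iff h' he').1 hp').1
  obtain ⟨U, hU, hUo⟩ := hbi e he e' he' y ⟨hy₁, hy₂⟩
  obtain ⟨U', hU', hUo'⟩ := hbi e' he' e he y ⟨hy₂, hy₁⟩
  have hev := (eventually_mem_leafArc_source h he hp (inter_mem hU hU')).and
    (eventually_mem_leafArc_source h' he' hp' univ_mem)
  filter_upwards [hev] with q hq
  obtain ⟨⟨hq₁, hqU, hqU'⟩, hq₂, -⟩ := hq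
  set z : X := ofLeafSpace (q : F.LeafSpace) with hz
  have hz₁ : z ∈ e.source := ((mem_leafArc_source_iff h he).1 hq₁).1
  have hz₂ : z ∈ e'.source := ((mem_leafArc_source_iff h' he').1 hq₂).1
  rw [leafArc_apply h he hq₁, leafArc_apply h he hp, leafArc_apply h' he' hq₂, leafArc_apply h' he' hp']
  -- both points lie on the plaques of both boxes
  have het : (e y).2 = (e z).2 := by
    rw [snd_eq_of_mem_leafArc_source h he hp, snd_eq_of_mem_leafArc_source h he hq₁]
  have het' : (e' y).2 = (e' z).2 := by
    rw [snd_eq_of_mem_leafArc_source h' he' hp', snd_eq_of_mem_leafArc_source h' he' hq₂]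
  have hyU : y ∈ U ∩ (e.source ∩ e'.source) := ⟨mem_of_mem_nhds hU, hy₁, hy₂⟩
  have hzU : z ∈ U ∩ (e.source ∩ e'.source) := ⟨hqU, hz₁, hz₂⟩
  have hyU' : y ∈ U' ∩ (e'.source ∩ e.source) := ⟨mem_of_mem_nhds hU', hy₂, hy₁⟩
  have hzU' : z ∈ U' ∩ (e'.source ∩ e.source) := ⟨hqU', hz₂, hz₁⟩
  constructor
  · constructor
    · exact fun hlt ↦ hUo z hzU y hyU het.symm hlt
    · exact fun hlt ↦ hUo' z hzU' y hyU' het'.symm hlt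
  · constructor
    · exact fun hlt ↦ hUo y hyU z hzU het hlt
    · exact fun hlt ↦ hUo' y hyU' z hzU' het' hlt

end Compatible

end Literature.Topology.PlanarFoliations
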